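import Mathlib.Analysis.InnerProductSpace.Continuous
import Mathlib.Analysis.Normed.Operator.Extend

/-!
# Stub `stub_pencilOfGreenKubo` of line `cayley-pencil` (crux `ContactStieltjesMeasure.StieltjesRepresentation`,
# stmt-AtomisticToContinuum-15248), part 1: the abstract extension lemma for dissipative pencils

Helper file (`--supports stmt-AtomisticToContinuum-15248`). Pure Hilbert-space functional analysis, no chain.

A *core* for a dissipative pencil on a real Hilbert space `K`: an `ℝ`-module `E` (think: nice vector fields), a
linear map `ι : E →ₗ[ℝ] K` with dense range (think: inclusion into `L²(μ_T)²`), and two families of maps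
`T T' : ℝ → E → K` (think: `F ↦ D R_γ D* F` and its adjoint `F ↦ D R_γ† D* F`, computed on nice `F` through smooth
Poisson solutions) such that, for positive parameters and on the core,
* (E₀) `⟪ι u, T γ u⟫ = γ ‖T γ u‖²` and `⟪ι u, T' γ u⟫ = γ ‖T' γ u‖²` (energy identities),
* (A₀) `⟪T γ u, ι u'⟫ = ⟪ι u, T' γ u'⟫` (mutual adjointness),
* (C₀) `⟪T γ u - T γ' u, ι u'⟫ = (γ' - γ) ⟪T γ' u, T' γ u'⟫` (the pencil identity in weak, cross-friction form).
Then (`exists_pencil_of_core`) there is `W : ℝ → K →L[ℝ] K` extending `T` (`W γ (ι u) = T γ u`) with the pencil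
resolvent identity (R) `W γ f - W γ' f = (γ' - γ) • W γ (W γ' f)` and the energy identity (E) `⟪f, W γ f⟫ = γ‖W γ f‖²`
for all `f ∈ K`, `γ, γ' > 0`. Linearity of `T γ` is NOT assumed: it follows from (A₀) and density; boundedness
`‖T γ u‖ ≤ ‖ι u‖/γ` follows from (E₀); `W γ` is `LinearMap.extendOfNorm`; (E), adjointness and (R) pass to the closure
by `DenseRange.induction_on`. No definitions.
-/

noncomputable section

open scoped RealInnerProductSpace

namespace Summit.AtomisticToContinuum.FouriersLaw.Theorems.ContactStieltjesMeasure.CayleyPencil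

namespace Pencil

variable {K : Type*} [NormedAddCommGroup K] [InnerProductSpace ℝ K]
variable {E : Type*} [AddCommGroup E] [Module ℝ E]

/-! ### Density bookkeeping -/

/-- A vector orthogonal to a dense range is zero. [folklore] -/
theorem eq_zero_of_inner_denseRange_right {ι : E →ₗ[ℝ] K} (hι : DenseRange ι) {x : K}
    (h : ∀ u, ⟪x, ι u⟫ = 0) : x = 0 := by
  have hall : ∀ y : K, ⟪x, y⟫ = 0 := fun y =>
    hι.induction_on y (isClosed_eq (continuous_const.inner continuous_id) continuous_const) h
  exact inner_self_eq_zero.mp (hall x)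

/-- A vector orthogonal (on the left) to a dense range is zero. [folklore] -/
theorem eq_zero_of_inner_denseRange_left {ι : E →ₗ[ℝ] K} (hι : DenseRange ι) {x : K}
    (h : ∀ u, ⟪ι u, x⟫ = 0) : x = 0 :=
  eq_zero_of_inner_denseRange_right hι fun u => by rw [real_inner_comm]; exact h u

/-- The norm bound `‖T u‖ ≤ γ⁻¹ ‖ι u‖` from the energy identity `⟪ι u, T u⟫ = γ ‖T u‖²` and Cauchy–Schwarz (no
spectral gap is involved). [cite: LaxPhillips1967, Ch. II §3] -/
theorem norm_le_of_energy {γ : ℝ} (hγ : 0 < γ) {a t : K} (h : ⟪a, t⟫ = γ * ‖t‖ ^ 2) :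
    ‖t‖ ≤ γ⁻¹ * ‖a‖ := by
  have hcs : ⟪a, t⟫ ≤ ‖a‖ * ‖t‖ := real_inner_le_norm a t
  rw [h] at hcs
  rcases (norm_nonneg t).eq_or_lt with h0 | hpos
  · rw [← h0]; positivity
  · have h1 : γ * ‖t‖ ≤ ‖a‖ := by nlinarith
    calc ‖t‖ = γ⁻¹ * (γ * ‖t‖) := by field_simp
      _ ≤ γ⁻¹ * ‖a‖ := by gcongr

/-! ### Linearity of the core maps from adjointness -/

section Core

variable (ι : E →ₗ[ℝ] K) (T T' : E → K)

/-- Additivity of a map `T : E → K` that has an adjoint `T'` on a dense core: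
`⟪T u, ι u'⟫ = ⟪ι u, T' u'⟫` forces `T (u + v) = T u + T v`. [folklore] -/
theorem map_add_of_adjoint (hι : DenseRange ι) (hadj : ∀ u u', ⟪T u, ι u'⟫ = ⟪ι u, T' u'⟫) (u v : E) :
    T (u + v) = T u + T v := by
  have h : ∀ u', ⟪T (u + v) - (T u + T v), ι u'⟫ = 0 := fun u' => by
    rw [inner_sub_left, inner_add_left, hadj, hadj, hadj, map_add, inner_add_left, sub_self]
  exact sub_eq_zero.mp (eq_zero_of_inner_denseRange_right hι h)

/-- Homogeneity, companion of `map_add_of_adjoint`. [folklore] -/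
theorem map_smul_of_adjoint (hι : DenseRange ι) (hadj : ∀ u u', ⟪T u, ι u'⟫ = ⟪ι u, T' u'⟫) (c : ℝ) (u : E) :
    T (c • u) = c • T u := by
  have h : ∀ u', ⟪T (c • u) - c • T u, ι u'⟫ = 0 := fun u' => by
    rw [inner_sub_left, inner_smul_left, hadj, hadj, map_smul, inner_smul_left, sub_self]
  exact sub_eq_zero.mp (eq_zero_of_inner_denseRange_right hι h)

/-- Additivity of the ADJOINT core map `T'` (same argument on the other side). [folklore] -/
theorem map_add_of_adjoint' (hι : DenseRange ι) (hadj : ∀ u u', ⟪T u, ι u'⟫ = ⟪ι u, T' u'⟫) (u v : E) :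
    T' (u + v) = T' u + T' v := by
  have h : ∀ u', ⟪ι u', T' (u + v) - (T' u + T' v)⟫ = 0 := fun u' => by
    rw [inner_sub_right, inner_add_right, ← hadj, ← hadj, ← hadj, map_add, inner_add_right, sub_self]
  exact sub_eq_zero.mp (eq_zero_of_inner_denseRange_left hι h)

/-- Homogeneity of the adjoint core map. [folklore] -/
theorem map_smul_of_adjoint' (hι : DenseRange ι) (hadj : ∀ u u', ⟪T u, ι u'⟫ = ⟪ι u, T' u'⟫) (c : ℝ) (u : E) :
    T' (c • u) = c • T' u := by
  have h : ∀ u', ⟪ι u', T' (c • u) - c • T' u⟫ = 0 := fun u' => by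
    rw [inner_sub_right, inner_smul_right, ← hadj, ← hadj, map_smul, inner_smul_right, sub_self]
  exact sub_eq_zero.mp (eq_zero_of_inner_denseRange_left hι h)

end Core

/-! ### The extension and its identities -/

section Extend

variable [CompleteSpace K]
variable {ι : E →ₗ[ℝ] K} (hι : DenseRange ι) {γ : ℝ} (hγ : 0 < γ) (Tl Tl' : E →ₗ[ℝ] K)
  (hE : ∀ u, ⟪ι u, Tl u⟫ = γ * ‖Tl u‖ ^ 2) (hE' : ∀ u, ⟪ι u, Tl' u⟫ = γ * ‖Tl' u‖ ^ 2)
  (hadj : ∀ u u', ⟪Tl u, ι u'⟫ = ⟪ι u, Tl' u'⟫)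
include hι hγ hE

/-- The bounded extension `W` of the (linear) core map `Tl` to all of `K` agrees with `Tl` on the core
(`LinearMap.extendOfNorm` with the bound `‖Tl u‖ ≤ γ⁻¹‖ι u‖` from the energy identity). [folklore] -/
theorem extend_apply_core (u : E) : Tl.extendOfNorm ι (ι u) = Tl u :=
  LinearMap.extendOfNorm_eq hι ⟨γ⁻¹, fun v => norm_le_of_energy hγ (hE v)⟩ u

/-- **The energy identity passes to the closure**: `⟪f, W f⟫ = γ ‖W f‖²` for every `f ∈ K` (both sides are
continuous in `f` and agree on the dense range of `ι`). [cite: LaxPhillips1967, Ch. II §3] -/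
theorem inner_extend_eq (f : K) : ⟪f, Tl.extendOfNorm ι f⟫ = γ * ‖Tl.extendOfNorm ι f‖ ^ 2 := by
  set W := Tl.extendOfNorm ι with hW
  refine hι.induction_on f ?_ ?_
  · exact isClosed_eq (continuous_id.inner W.continuous) (continuous_const.mul ((W.continuous.norm).pow 2))
  · intro u
    show ⟪ι u, W (ι u)⟫ = γ * ‖W (ι u)‖ ^ 2
    rw [hW, extend_apply_core hι hγ Tl hE u]
    exact hE u

include hE' hadj in
/-- **Adjointness passes to the closure**: `⟪W f, g⟫ = ⟪f, W' g⟫` for all `f, g ∈ K` (density in each variable).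
[folklore] -/
theorem inner_extend_left_eq (f g : K) : ⟪Tl.extendOfNorm ι f, g⟫ = ⟪f, Tl'.extendOfNorm ι g⟫ := by
  set W := Tl.extendOfNorm ι with hW
  set W' := Tl'.extendOfNorm ι with hW'
  -- first for `g = ι u'` and all `f`
  have h1 : ∀ u', ∀ f : K, ⟪W f, ι u'⟫ = ⟪f, W' (ι u')⟫ := by
    intro u' f
    refine hι.induction_on f ?_ ?_
    · exact isClosed_eq (W.continuous.inner continuous_const) (continuous_id.inner continuous_const)
    · intro u
      show ⟪W (ι u), ι u'⟫ = ⟪ι u, W' (ι u')⟫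
      rw [hW, hW', extend_apply_core hι hγ Tl hE u, extend_apply_core hι hγ Tl' hE' u']
      exact hadj u u'
  refine hι.induction_on g ?_ ?_
  · exact isClosed_eq (continuous_const.inner continuous_id) (continuous_const.inner W'.continuous)
  · intro u'
    exact h1 u' f

end Extend

/-- **Dissipative pencils from a core (abstract extension lemma).** Let `K` be a real Hilbert space, `E` an
`ℝ`-module, `ι : E →ₗ[ℝ] K` with dense range, and `T T' : ℝ → E → K` such that for all `γ, γ' > 0` and `u, u' ∈ E`:
(E₀) `⟪ι u, T γ u⟫ = γ‖T γ u‖²`, (E₀') `⟪ι u, T' γ u⟫ = γ‖T' γ u‖²`, (A₀) `⟪T γ u, ι u'⟫ = ⟪ι u, T' γ u'⟫`,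
(C₀) `⟪T γ u - T γ' u, ι u'⟫ = (γ' - γ)⟪T γ' u, T' γ u'⟫`. Then there is a family `W : ℝ → K →L[ℝ] K` extending
`T` on the core (`W γ (ι u) = T γ u`, `γ > 0`) that satisfies the pencil resolvent identity
(R) `W γ f - W γ' f = (γ' - γ) • W γ (W γ' f)` and the energy identity (E) `⟪f, W γ f⟫ = γ‖W γ f‖²` on all of `K` for
`γ, γ' > 0`. (Linearity and boundedness of `T γ` are consequences; `W γ := 0` for `γ ≤ 0`.)
[cite: LaxPhillips1967, Ch. II §3] -/
theorem exists_pencil_of_core {K : Type*} [NormedAddCommGroup K] [InnerProductSpace ℝ K] [CompleteSpace K]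
    {E : Type*} [AddCommGroup E] [Module ℝ E] (ι : E →ₗ[ℝ] K) (hι : DenseRange ι) (T T' : ℝ → E → K)
    (hE : ∀ γ : ℝ, 0 < γ → ∀ u, ⟪ι u, T γ u⟫ = γ * ‖T γ u‖ ^ 2)
    (hE' : ∀ γ : ℝ, 0 < γ → ∀ u, ⟪ι u, T' γ u⟫ = γ * ‖T' γ u‖ ^ 2)
    (hadj : ∀ γ : ℝ, 0 < γ → ∀ u u', ⟪T γ u, ι u'⟫ = ⟪ι u, T' γ u'⟫)
    (hcross : ∀ γ γ' : ℝ, 0 < γ → 0 < γ' → ∀ u u',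
      ⟪T γ u - T γ' u, ι u'⟫ = (γ' - γ) * ⟪T γ' u, T' γ u'⟫) :
    ∃ W : ℝ → K →L[ℝ] K,
      (∀ γ γ' : ℝ, 0 < γ → 0 < γ' → ∀ f : K, W γ f - W γ' f = (γ' - γ) • W γ (W γ' f)) ∧
      (∀ γ : ℝ, 0 < γ → ∀ f : K, ⟪f, W γ f⟫ = γ * ‖W γ f‖ ^ 2) ∧
      ∀ γ : ℝ, 0 < γ → ∀ u, W γ (ι u) = T γ u := by
  classical
  -- the core maps are linear (adjointness on a dense core), parameter by parameter
  let Tl : ∀ γ : ℝ, 0 < γ → (E →ₗ[ℝ] K) := fun γ hγ =>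
    { toFun := T γ
      map_add' := map_add_of_adjoint ι (T γ) (T' γ) hι (hadj γ hγ)
      map_smul' := map_smul_of_adjoint ι (T γ) (T' γ) hι (hadj γ hγ) }
  let Tl' : ∀ γ : ℝ, 0 < γ → (E →ₗ[ℝ] K) := fun γ hγ =>
    { toFun := T' γ
      map_add' := map_add_of_adjoint' ι (T γ) (T' γ) hι (hadj γ hγ)
      map_smul' := map_smul_of_adjoint' ι (T γ) (T' γ) hι (hadj γ hγ) }
  have hTl : ∀ γ (hγ : 0 < γ) u, Tl γ hγ u = T γ u := fun γ hγ u => rfl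
  have hTl' : ∀ γ (hγ : 0 < γ) u, Tl' γ hγ u = T' γ u := fun γ hγ u => rfl
  -- the extensions, parameter by parameter (`0` for non-positive parameters)
  let W : ℝ → K →L[ℝ] K := fun γ => if hγ : 0 < γ then (Tl γ hγ).extendOfNorm ι else 0
  let W' : ℝ → K →L[ℝ] K := fun γ => if hγ : 0 < γ then (Tl' γ hγ).extendOfNorm ι else 0
  have hWpos : ∀ γ (hγ : 0 < γ), W γ = (Tl γ hγ).extendOfNorm ι := fun γ hγ => by simp only [W, dif_pos hγ]
  have hW'pos : ∀ γ (hγ : 0 < γ), W' γ = (Tl' γ hγ).extendOfNorm ι := fun γ hγ => by simp only [W', dif_pos hγ]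
  have hEl : ∀ γ (hγ : 0 < γ) u, ⟪ι u, Tl γ hγ u⟫ = γ * ‖Tl γ hγ u‖ ^ 2 := fun γ hγ u => hE γ hγ u
  have hEl' : ∀ γ (hγ : 0 < γ) u, ⟪ι u, Tl' γ hγ u⟫ = γ * ‖Tl' γ hγ u‖ ^ 2 := fun γ hγ u => hE' γ hγ u
  have hadjl : ∀ γ (hγ : 0 < γ) u u', ⟪Tl γ hγ u, ι u'⟫ = ⟪ι u, Tl' γ hγ u'⟫ := fun γ hγ u u' => hadj γ hγ u u'
  have hcore : ∀ γ : ℝ, 0 < γ → ∀ u, W γ (ι u) = T γ u := fun γ hγ u => by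
    rw [hWpos γ hγ, ← hTl γ hγ u]; exact extend_apply_core hι hγ (Tl γ hγ) (hEl γ hγ) u
  have hcore' : ∀ γ : ℝ, 0 < γ → ∀ u, W' γ (ι u) = T' γ u := fun γ hγ u => by
    rw [hW'pos γ hγ, ← hTl' γ hγ u]; exact extend_apply_core hι hγ (Tl' γ hγ) (hEl' γ hγ) u
  have henergy : ∀ γ : ℝ, 0 < γ → ∀ f : K, ⟪f, W γ f⟫ = γ * ‖W γ f‖ ^ 2 := fun γ hγ f => by
    rw [hWpos γ hγ]; exact inner_extend_eq hι hγ (Tl γ hγ) (hEl γ hγ) f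
  have hadjW : ∀ γ : ℝ, 0 < γ → ∀ f g : K, ⟪W γ f, g⟫ = ⟪f, W' γ g⟫ := fun γ hγ f g => by
    rw [hWpos γ hγ, hW'pos γ hγ]
    exact inner_extend_left_eq hι hγ (Tl γ hγ) (Tl' γ hγ) (hEl γ hγ) (hEl' γ hγ) (hadjl γ hγ) f g
  refine ⟨W, fun γ γ' hγ hγ' f => ?_, henergy, hcore⟩
  -- (R): the weak cross identity on the core, closed up in both variables, then adjointness
  have h1 : ∀ u', ∀ f : K, ⟪W γ f - W γ' f, ι u'⟫ = (γ' - γ) * ⟪W γ' f, W' γ (ι u')⟫ := by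
    intro u' f
    refine hι.induction_on f ?_ ?_
    · exact isClosed_eq (((W γ).continuous.sub (W γ').continuous).inner continuous_const)
        (continuous_const.mul ((W γ').continuous.inner continuous_const))
    · intro u
      show ⟪W γ (ι u) - W γ' (ι u), ι u'⟫ = (γ' - γ) * ⟪W γ' (ι u), W' γ (ι u')⟫
      rw [hcore γ hγ, hcore γ' hγ', hcore' γ hγ]
      exact hcross γ γ' hγ hγ' u u'
  have hweak : ∀ g : K, ⟪W γ f - W γ' f, g⟫ = (γ' - γ) * ⟪W γ' f, W' γ g⟫ := by
    intro g
    refine hι.induction_on g ?_ ?_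
    · exact isClosed_eq (continuous_const.inner continuous_id)
        (continuous_const.mul (continuous_const.inner (W' γ).continuous))
    · intro u'
      exact h1 u' f
  have hzero : ∀ g : K, ⟪W γ f - W γ' f - (γ' - γ) • W γ (W γ' f), g⟫ = 0 := fun g => by
    rw [inner_sub_left, inner_smul_left, hweak g, hadjW γ hγ (W γ' f) g]
    simp
  exact sub_eq_zero.mp (inner_self_eq_zero.mp (hzero _))

end Pencil

open Pencil in
/-- **Registered sub-goal `stub_pencilOfGreenKubo_abstractCore`** of the crux (this file's ticket): the abstract
extension lemma `exists_pencil_of_core` in registered (`Type`-level, `inner ℝ`) spelling. [cite: LaxPhillips1967, Ch. II §3] -/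
theorem stub_pencilOfGreenKubo_abstractCore :
    ∀ (K : Type) [NormedAddCommGroup K] [InnerProductSpace ℝ K] [CompleteSpace K] (E : Type) [AddCommGroup E] [Module ℝ E] (ι : E →ₗ[ℝ] K), DenseRange ι → ∀ (T T' : ℝ → E → K), (∀ γ : ℝ, 0 < γ → ∀ u, inner ℝ (ι u) (T γ u) = γ * ‖T γ u‖ ^ 2) → (∀ γ : ℝ, 0 < γ → ∀ u, inner ℝ (ι u) (T' γ u) = γ * ‖T' γ u‖ ^ 2) → (∀ γ : ℝ, 0 < γ → ∀ u u', inner ℝ (T γ u) (ι u') = inner ℝ (ι u) (T' γ u')) → (∀ γ γ' : ℝ, 0 < γ → 0 < γ' → ∀ u u', inner ℝ (T γ u - T γ' u) (ι u') = (γ' - γ) * inner ℝ (T γ' u) (T' γ u')) → ∃ W : ℝ → K →L[ℝ] K, (∀ γ γ' : ℝ, 0 < γ → 0 < γ' → ∀ f : K, W γ f - W γ' f = (γ' - γ) • W γ (W γ' f)) ∧ (∀ γ : ℝ, 0 < γ → ∀ f : K, inner ℝ f (W γ f) = γ * ‖W γ f‖ ^ 2) ∧ ∀ γ : ℝ, 0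 < γ → ∀ u, W γ (ι u) = T γ u :=
  fun _ _ _ _ _ _ _ ι hι T T' hE hE' hadj hcross => exists_pencil_of_core ι hι T T' hE hE' hadj hcross

end Summit.AtomisticToContinuum.FouriersLaw.Theorems.ContactStieltjesMeasure.CayleyPencil

end
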